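import Mathlib.AlgebraicTopology.FundamentalGroupoid.SimplyConnected
import Literature.Geometry.Lorentzian.KillingHorizonShadowAlong
import HarnessLib

/-!
# Nomizu's theorem: Killing fields of a simply connected real-analytic pseudo-Riemannian manifold
# extend from connected open subsets (Nomizu 1960; pseudo-Riemannian reading: Chruściel 1997)

Topic `Geometry/Lorentzian` (family `gr`), cite/fact items `wi-26088` / `wi-26074`: the classical
analytic-continuation theorem for Killing vector fields,

> K. Nomizu, *On local and global existence of Killing vector fields*, Ann. of Math. (2) 72 (1960)
> 105–120, Theorems 1–2,

vendored as ONE named fact over the tree's pseudo-Riemannian vocabulary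
(`Literature.Geometry.Lorentzian.PseudoRiemannianMetric` at regularity `ω`,
`PseudoRiemannianMetric.IsKillingFieldOn` / `.IsKillingField`, `KillingHorizonShadowAlong.lean`,
`LeviCivita.lean`).

## Sources and what is printed

The primary source is not held (JSTOR, acquisition request `acq-02952`). The statement is taken
from the secondary source that restates it in exactly the generality needed here (any signature),

> P. T. Chruściel, *On rigidity of analytic black holes*, Commun. Math. Phys. 189 (1997) 1–7
> (arXiv:gr-qc/9610011), §2:

"We shall need the following result, which is a straightforward consequence [footnote: Actually in
[Nomizu] it is assumed that `(M, g_{ab})` is Riemannian. The reader will note that all the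
assertions and proofs of [Nomizu] remain valid word for word when "Riemannian" is replaced by
"pseudo-Riemannian".] of what has been proved in [Nomizu]: **Theorem 2.1 (Nomizu).** Let
`(M, g_{ab})` be a (connected) simply connected analytic pseudo-Riemannian manifold, and suppose
that there exists a Killing vector field `Y` defined on an open connected subset `𝒪` of `M`. Then
there exists a Killing vector field `Ŷ` defined on `M` which coincides with `Y` on `𝒪`."

(Also restated, statement only, in A. Zeghib, *Geometry of warped products*, arXiv:1107.0411,
§9.1.2: "assume that `M` is simply connected and analytic … A classical result [Nom] states that an
analytic Killing field defined on an open subset extends as a Killing field to the whole of `M`.")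

## Rendering

* "analytic pseudo-Riemannian manifold": a real-analytic manifold `M` (`IsManifold I ω M`)
  modelled, without boundary (`I.Boundaryless`), on a finite-dimensional complete real normed space
  `E`, Hausdorff and second countable (the standing conventions of both sources), carrying a `C^ω`
  pseudo-Riemannian metric `g` on `TM` of arbitrary signature
  (`PseudoRiemannianMetric I ω E (TangentSpace I)`, O'Neill's Def. 3.1 at regularity `ω`) with its
  Levi-Civita connection (`[g.HasLeviCivita]`, an instance in the tree, `LeviCivitaProofs.lean`);
  "(connected) simply connected": Mathlib's `SimplyConnectedSpace M` (which entails path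
  connectedness).
* "a Killing vector field `Y` defined on an open connected subset `𝒪`": `IsOpen 𝒪`,
  `IsConnected 𝒪` (non-empty; the empty case is trivial) and `g.IsKillingFieldOn Y 𝒪` — `Y` is
  `C^ω` on `𝒪` as a section of `TM` and satisfies Killing's equation
  `g(∇_v Y, w) + g(v, ∇_w Y) = 0` at every point of `𝒪` (O'Neill 1983, Ch. 9, Def. 22 / Prop. 25
  (3)). The tree's Killing notions carry the metric's regularity exponent, here `ω`; in the
  `∀`-position this demand only WEAKENS the vendored fact relative to print.
* conclusion: a GLOBAL Killing field `Ŷ` of `g` (`g.IsKillingField Ŷ`: `C^ω` on `M`, Killing's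
  equation at every point) with `Ŷ x = Y x` for all `x ∈ 𝒪` — "there exists a Killing vector field
  `Ŷ` defined on `M` which coincides with `Y` on `𝒪`"; the extension of [Nomizu] is produced by
  analytic continuation of the analytic data. Uniqueness of `Ŷ` (two Killing fields of a connected
  manifold that agree on a non-empty open set agree everywhere, O'Neill 1983, Ch. 9, Lemma 27 ff.)
  is NOT part of the printed Theorem 2.1 and is not vendored here.
* Values of vector fields off `𝒪` are irrelevant junk on the hypothesis side (`Y` is a global
  section constrained only on `𝒪`).

## References

* K. Nomizu, Ann. of Math. (2) 72 (1960) 105–120, Theorems 1–2. [`Nomizu1960`]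
* P. T. Chruściel, Commun. Math. Phys. 189 (1997) 1–7, Thm. 2.1 (arXiv:gr-qc/9610011). [`Chrusciel1997`]
* B. O'Neill, *Semi-Riemannian geometry* (1983), Ch. 9, Def. 22, Prop. 25, Lemma 27. [`ONeillSemiRiemannian1983`]
-/

noncomputable section

open Bundle Set
open scoped Manifold ContDiff Topology

namespace Literature.Geometry.Lorentzian

universe u v w

/-- **Nomizu's extension theorem for Killing fields (Nomizu 1960, Thms. 1–2; pseudo-Riemannian
reading: Chruściel 1997, Thm. 2.1).** "Let `(M, g)` be a (connected) simply connected analytic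
pseudo-Riemannian manifold, and suppose that there exists a Killing vector field `Y` defined on an
open connected subset `𝒪` of `M`. Then there exists a Killing vector field `Ŷ` defined on `M` which
coincides with `Y` on `𝒪`." Rendered (module docstring, *Rendering*): `M` a real-analytic
(`IsManifold I ω M`), boundaryless, Hausdorff, second countable manifold modelled on a
finite-dimensional complete real normed space, simply connected (`SimplyConnectedSpace M`); `g` a
`C^ω` pseudo-Riemannian metric on `TM` (any signature) with its Levi-Civita connection; `𝒪` open,
connected and non-empty; `Y` a Killing field of `g` on `𝒪` in the tree's sense at regularity `ω`
(`g.IsKillingFieldOn Y 𝒪`); conclusion: a global Killing field `Ŷ` of `g` (`g.IsKillingField Ŷ`)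
with `Ŷ x = Y x` for every `x ∈ 𝒪`. Printed for Riemannian `g` in [Nomizu1960]; "all the
assertions and proofs of [Nomizu] remain valid word for word when "Riemannian" is replaced by
"pseudo-Riemannian"" [Chrusciel1997, footnote to Thm. 2.1].
[cite: Nomizu1960, Theorems 1–2] [cite: Chrusciel1997, Thm. 2.1 (with footnote)] -/
def Nomizu1960KillingExtension : Prop :=
  ∀ {E : Type u} [NormedAddCommGroup E] [NormedSpace ℝ E] [FiniteDimensional ℝ E]
    [CompleteSpace E] {H : Type v} [TopologicalSpace H] {I : ModelWithCorners ℝ E H}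
    [I.Boundaryless] {M : Type w} [TopologicalSpace M] [ChartedSpace H M] [IsManifold I ω M]
    [T2Space M] [SecondCountableTopology M] [SimplyConnectedSpace M]
    (g : PseudoRiemannianMetric I ω E (TangentSpace I : M → Type _)) [g.HasLeviCivita]
    {O : Set M}, IsOpen O → IsConnected O →
    ∀ {Y : Π x : M, TangentSpace I x}, g.IsKillingFieldOn Y O →
      ∃ Yhat : Π x : M, TangentSpace I x, g.IsKillingField Yhat ∧ ∀ x ∈ O, Yhat x = Y x

/-- The trivial instance of the extension problem, recorded as a sanity check of the rendering:
a field which is ALREADY a global Killing field extends (by itself) from every set. [folklore] -/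
theorem PseudoRiemannianMetric.IsKillingField.exists_extension_self
    {E : Type u} [NormedAddCommGroup E] [NormedSpace ℝ E] [FiniteDimensional ℝ E] [CompleteSpace E]
    {H : Type v} [TopologicalSpace H] {I : ModelWithCorners ℝ E H}
    {M : Type w} [TopologicalSpace M] [ChartedSpace H M] [IsManifold I ω M]
    (g : PseudoRiemannianMetric I ω E (TangentSpace I : M → Type _)) [g.HasLeviCivita]
    (O : Set M) {Y : Π x : M, TangentSpace I x} (hY : g.IsKillingField Y) :
    ∃ Yhat : Π x : M, TangentSpace I x, g.IsKillingField Yhat ∧ ∀ x ∈ O, Yhat x = Y x :=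
  ⟨Y, hY, fun _ _ => rfl⟩

end Literature.Geometry.Lorentzian

end
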